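import Mathlib
import Summits.Schanuel.Schanuel.Theses.LogPatterns
import Literature.NumberTheory.Transcendental.KirbyWeakSchanuelAx

/-!
# Birth skeleton for the piece `OffLogSector` (item stmt-Schanuel-4311) of the split of `RankLeTrdeg`

Seat `planner-cstrat-stmt-Schanuel-3486-r1-0` (crux-strategist, BC2 redirect of
`ExpMordellWeil.RankLeTrdeg` into `LogSector ∧ OffLogSector`; BC3 "skeleton per piece").
`OffLogSector` = Schanuel RELATIVE to the field of logarithms `K₀ = ℚ(𝓛)`, `𝓛 = exp⁻¹(ℚ̄)`, for
tuples `ℚ`-linearly independent modulo `𝓛`; concluded BY NAME as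
`Summit.Schanuel.Schanuel.Theses.LogPatterns.OffLogSector` (shared decl of item 4311; the
`ExpMordellWeil.OffLogSector` child written by `route edit --split` has the identical statement).

LINE (regime removal by Kirby's relative Schanuel THEOREM over the core `E = ecl ∅ ⊇ 𝓛`):
* the GENERIC regime — tuples `ℚ`-independent modulo `span E` — is settled UNCONDITIONALLY by the
  tree theorem `Literature.NumberTheory.Transcendental.kirby_relative_schanuel_complex_holds`
  (Kirby 2010 Thm. 1.2 at `F = ℂ_exp`, `C = ecl ∅`; Ax 1971 Thm. 3), used BY NAME in the
  composition;
* `stub_coreOffLog` (hard) — the CORE regime: tuples FROM `E` that are `ℚ`-independent modulo `𝓛`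
  have `trdeg_{K₀} K₀(y, e^y) ≥ |y|` (contains `e ∉ \overline{ℚ(𝓛)}`; every coordinate is a
  coordinate of an isolated zero of a square exponential-polynomial system over `ℚ` — Khovanskii
  points, countably many, enumerable — the arena of the RigidCore cruxes
  `SchanuelOnLogFreeCore` / `MinimalCounterexampleInAcl`);
* `stub_relativeSectorBookkeeping` (provable now, L) — Kirby's `GL_n(ℚ)` adapted-basis
  bookkeeping run RELATIVE to `K₀` at the pair of `ℚ`-subspaces `𝓛 ⊆ E`: for `x` independent
  mod `𝓛` split `span x = W ⊕ U`, `W = span x ∩ E`, integer-rescaled bases `y ⊂ W`, `z ⊂ U`;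
  inside `k ≤ trdeg_{K₀} K₀(y,e^y)`, outside `m ≤ trdeg_{ℚ(E)} ℚ(E)(z,e^z) ≤
  trdeg_{K₀(y,e^y)} K₀(y,e^y)(z,e^z)` (base change DOWN along `K₀(y,e^y) ≤ ℚ(E)`: `y, e^y ∈ E`,
  `𝓛 ⊆ E`), tower law `k + m = n`, monotonicity along `K₀(y,z,e^y,e^z) ≤ K₀(x,e^x)` — the
  relative twin of the tree's `schanuel_of_sector_split_set` (SchanuelSectorSplit.lean, ~180 lines);
* `OffLogSector_of` — composition: `stub_relativeSectorBookkeeping stub_coreOffLog kirby_…_holds`.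
-/

noncomputable section

set_option linter.dupNamespace false

namespace Summit.Schanuel.Schanuel.Cruxes.RankLeTrdeg.OffLogSectorBirth

open Summit.Schanuel.Schanuel.Theses.LogPatterns (OffLogSector)
open Literature.NumberTheory.Transcendental
  (ecl kirby_relative_schanuel_complex kirby_relative_schanuel_complex_holds)

/-- STUB 1 (hard): `OffLogSector` ON KIRBY'S CORE `E = ecl ∅` — tuples from `E` that are
`ℚ`-linearly independent modulo `𝓛` generate over `K₀ = ℚ(𝓛)`, together with their
exponentials, a field of transcendence degree `≥ |y|`. [Kirby2010EAEF = arXiv:0810.4285, Thm 1.2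
and Prop. 7.2 ("essential counterexamples lie in ecl ∅"); BaysKirby2018 §9] -/
theorem stub_coreOffLog :
    ∀ (k : ℕ) (y : Fin k → ℂ), (∀ i, y i ∈ ecl (∅ : Set ℂ)) →
      LinearIndependent ℚ ((Submodule.span ℚ {z : ℂ | IsAlgebraic ℚ (Complex.exp z)}).mkQ ∘ y) →
        (k : Cardinal) ≤
          Algebra.trdeg ↥(IntermediateField.adjoin ℚ {z : ℂ | IsAlgebraic ℚ (Complex.exp z)})
            ↥(IntermediateField.adjoin
              ↥(IntermediateField.adjoin ℚ {z : ℂ | IsAlgebraic ℚ (Complex.exp z)})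
              (Set.range y ∪ Set.range (Complex.exp ∘ y))) := by
  sorry

/-- STUB 2 (provable now, L): relative sector bookkeeping at `𝓛 ⊆ ecl ∅` — the core regime
(stub 1's statement) and the generic regime (Kirby's relative Schanuel theorem, by name) give
`OffLogSector` (conclusion WRITTEN OUT, so that only `OffLogSector_of` concludes the piece by name).
[Kirby2010EAEF, §1 and Prop. 7.2 (GL_n(ℚ) bookkeeping); tree
`Literature.NumberTheory.Transcendental.schanuel_of_sector_split_set` (absolute twin)] -/
theorem stub_relativeSectorBookkeeping :
    (∀ (k : ℕ) (y : Fin k → ℂ), (∀ i, y i ∈ ecl (∅ : Set ℂ)) →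
      LinearIndependent ℚ ((Submodule.span ℚ {z : ℂ | IsAlgebraic ℚ (Complex.exp z)}).mkQ ∘ y) →
        (k : Cardinal) ≤
          Algebra.trdeg ↥(IntermediateField.adjoin ℚ {z : ℂ | IsAlgebraic ℚ (Complex.exp z)})
            ↥(IntermediateField.adjoin
              ↥(IntermediateField.adjoin ℚ {z : ℂ | IsAlgebraic ℚ (Complex.exp z)})
              (Set.range y ∪ Set.range (Complex.exp ∘ y)))) →
    kirby_relative_schanuel_complex →
      ∀ (n : ℕ) (x : Fin n → ℂ),
        LinearIndependent ℚ ((Submodule.span ℚ {z : ℂ | IsAlgebraic ℚ (Complex.exp z)}).mkQ ∘ x) →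
          (n : Cardinal) ≤
            Algebra.trdeg ↥(IntermediateField.adjoin ℚ {z : ℂ | IsAlgebraic ℚ (Complex.exp z)})
              ↥(IntermediateField.adjoin
                ↥(IntermediateField.adjoin ℚ {z : ℂ | IsAlgebraic ℚ (Complex.exp z)})
                (Set.range x ∪ Set.range (Complex.exp ∘ x))) := by
  sorry

/-! ### Stub statements by name -/

namespace Statement

/-- Statement of `stub_coreOffLog`. -/
abbrev stub_coreOffLog : Prop := type_of% @OffLogSectorBirth.stub_coreOffLog
/-- Statement of `stub_relativeSectorBookkeeping`. -/
abbrev stub_relativeSectorBookkeeping : Prop :=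
  type_of% @OffLogSectorBirth.stub_relativeSectorBookkeeping

end Statement

/-- COMPOSITION (kernel-checked, no sorry; stub statements BY NAME): stub 2 fed with stub 1 and
Kirby's THEOREM `kirby_relative_schanuel_complex_holds` (tree, sorry-free) is the piece
`OffLogSector` by name (definitional unfolding of the route decl). -/
theorem OffLogSector_of (h₁ : Statement.stub_coreOffLog)
    (h₂ : Statement.stub_relativeSectorBookkeeping) : OffLogSector :=
  fun n x hx => h₂ h₁ kirby_relative_schanuel_complex_holds n x hx

/-- The piece along this line MODULO exactly the two registered stubs (depends on `sorryAx` only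
through `stub_*`). -/
theorem OffLogSector_proof : OffLogSector :=
  OffLogSector_of stub_coreOffLog stub_relativeSectorBookkeeping

end Summit.Schanuel.Schanuel.Cruxes.RankLeTrdeg.OffLogSectorBirth

end
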